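import Summits.Ventures.PercRepro.SixFourPLTrace

/-!
# PercRepro — C-025 at `(6,4)`, the residue's small-`g` piece: the bridge `PLData → PLTraceData / PLTraceDataNew` with
the cap `K = g − 3` as a parameter, and `Xcnt M G ≤ X̄′(profile D)` (mine-2 g21; for p2's residue draft
`SixFourResidueSmallG.lean`, lead (lh)(2) — the `Xcnt_le_Xbar'_profile` it leaves to `sorry`)

`SixFourPLTrace.lean` builds `PLData.traceData` under Theorem 22's hypotheses (plane traces `≤ 7`, `10 ≤ g`). The
`g ∈ {8, 9}` piece of `SixFourResidue` (dossier §21.18.9 via Lemma `X̄′`) has plane traces `≤ g − 3` and `7 ≤ g ≤ 10`;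
this file re-derives the bridge from the three facts the two settings share — `2 ≤ n`, `|ρ| ≤ 7` and a cap on the
class sizes — (`traceData_of`, `card_lineTraces_le_nu_of`), adds the `X̄′` facts `PLTraceDataNew` (`traceDataNew_of`:
the cap `s_j + 3 ≤ p`, a non-class line trace is a proper subset of `ρ`, `≤ ν_m` non-class traces of size `m`, and
`≥ 2` points per class in the meeting case), and composes `Xcnt_le_Xbar'_seam`:
**`PLData.Xcnt_le_Xbar'_profile`** — `Xcnt M G ≤ PL.Xbar' D.profile` for plane traces `≤ g − 3` and `7 ≤ g ≤ 10`.
Bodies of `traceData_of` / `card_lineTraces_le_nu_of` follow `SixFourPLTrace.lean` with the hypotheses generalised.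
-/

namespace PercRepro.SixFour

open Finset ThmH

variable {α : Type*} [DecidableEq α] {M : Matroid α} [M.Finite] {G : Finset α}

namespace PLData

variable {D : PLData M G}

/-- The bridge under the shared hypotheses: `2 ≤ n`, `3 ≤ n`, `|ρ| ≤ 7` and the cap `s_j + 2 ≤ p`. -/
theorem traceData_of (hs : Simple M) (hG : G ⊆ gr M) (h3 : 3 ≤ D.L.card) (hp7 : D.ρ.card ≤ 7)
    (hcap : ∀ A ∈ D.classes, A.card + 2 ≤ D.ρ.card) :
    PLTraceData D.profile D.ρ D.L D.classes D.lineTraces :=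
  have h2 : 2 ≤ D.L.card := by omega
  { disj := disjoint_ρ_L
    p_eq := rfl
    n_eq := rfl
    three_le := h3
    sizes_eq := by
      simp only [profile, sizes, Multiset.coe_reverse, Multiset.sort_eq]
    class_subset := by
      intro A hA
      obtain ⟨y, -, rfl⟩ := Finset.mem_image.1 hA
      exact Finset.inter_subset_right
    line_subset := by
      intro l hl
      obtain ⟨L', -, rfl⟩ := Finset.mem_image.1 (Finset.mem_filter.1 hl).1
      exact Finset.inter_subset_right
    class_line := by
      intro A hA l hl
      refine not_lt.1 fun hcon => ?_
      obtain ⟨a, ha, b, hb, hab⟩ := Finset.one_lt_card.1 hcon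
      obtain ⟨hmem, -, hncl⟩ := Finset.mem_filter.1 hl
      obtain ⟨L', hL', rfl⟩ := Finset.mem_image.1 hmem
      obtain ⟨hAl, hAρ⟩ := class_line hs hG h2 hA (by
        have := Finset.card_le_card (Finset.inter_subset_left : A ∩ (L' ∩ D.ρ) ⊆ A); omega)
      rw [Finset.mem_inter] at ha hb
      have haA : a ∈ clF M A := by have := ha.1; rw [← hAρ] at this; exact (Finset.mem_inter.1 this).1
      have hbA : b ∈ clF M A := by have := hb.1; rw [← hAρ] at this; exact (Finset.mem_inter.1 this).1
      have hLeq : clF M A = L' :=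
        lines_eq_of_two_mem hs hAl hL' haA hbA (Finset.mem_inter.1 ha.2).1 (Finset.mem_inter.1 hb.2).1 hab
      have hlA : L' ∩ D.ρ = A := by rw [← hLeq]; exact hAρ
      exact hncl (hlA ▸ hA)
    line_line := by
      intro l hl l' hl' hne
      refine not_lt.1 fun hcon => ?_
      obtain ⟨a, ha, b, hb, hab⟩ := Finset.one_lt_card.1 hcon
      obtain ⟨hmem, -, -⟩ := Finset.mem_filter.1 hl
      obtain ⟨L', hL', rfl⟩ := Finset.mem_image.1 hmem
      obtain ⟨hmem', -, -⟩ := Finset.mem_filter.1 hl'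
      obtain ⟨L'', hL'', rfl⟩ := Finset.mem_image.1 hmem'
      rw [Finset.mem_inter] at ha hb
      have := lines_eq_of_two_mem hs hL' hL'' (Finset.mem_inter.1 ha.1).1 (Finset.mem_inter.1 hb.1).1
        (Finset.mem_inter.1 ha.2).1 (Finset.mem_inter.1 hb.2).1 hab
      exact hne (by rw [this])
    class_class := by
      intro A hA B hB hne
      rw [e_profile_eq hs hG h2]
      congr 1
      refine Finset.Subset.antisymm (classes_inter_subset hs hG h2 hA hB hne) ?_
      intro z hz
      rw [Finset.mem_inter] at hz ⊢
      obtain ⟨y, -, rfl⟩ := Finset.mem_image.1 hA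
      obtain ⟨y', -, rfl⟩ := Finset.mem_image.1 hB
      exact ⟨mem_lam_of_mem_ellF hz.1 hz.2, mem_lam_of_mem_ellF hz.1 hz.2⟩
    cap := hcap
    nu_pos := by
      intro l hl
      obtain ⟨hmem, h2l, hncl⟩ := Finset.mem_filter.1 hl
      obtain ⟨L', hL', rfl⟩ := Finset.mem_image.1 hmem
      have hm7 : (L' ∩ D.ρ).card ≤ 7 := (Finset.card_le_card Finset.inter_subset_right).trans hp7
      have hinc : PL.incOf D.profile (L' ∩ D.ρ).card = inc M D.ρ (L' ∩ D.ρ).card := by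
        unfold PL.incOf
        rw [if_pos h2l, inc_profile _ (by omega)]
        congr 1
        omega
      have hcnt : D.profile.sizes.count (L' ∩ D.ρ).card =
          (D.classes.filter fun C => (L' ∩ D.ρ).card = C.card).card := sizes_count _
      show 0 < PL.incOf D.profile (L' ∩ D.ρ).card - D.profile.sizes.count (L' ∩ D.ρ).card
      rw [hinc, hcnt]
      apply Nat.sub_pos_of_lt
      unfold inc
      have hinj : Set.InjOn (fun C => clF M C) ↑(D.classes.filter fun C => (L' ∩ D.ρ).card = C.card) := by
        intro C hC C' hC' heq
        rw [Finset.mem_coe, Finset.mem_filter] at hC hC'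
        simp only at heq
        rw [← (class_line hs hG h2 hC.1 (by omega)).2, ← (class_line hs hG h2 hC'.1 (by omega)).2, heq]
      rw [← Finset.card_image_of_injOn hinj]
      apply Finset.card_lt_card
      refine ⟨?_, ?_⟩
      · intro X hX
        obtain ⟨C, hC, rfl⟩ := Finset.mem_image.1 hX
        rw [Finset.mem_filter] at hC
        obtain ⟨hLc, htr⟩ := class_line hs hG h2 hC.1 (by omega)
        rw [Finset.mem_filter, htr]
        exact ⟨hLc, hC.2.symm⟩
      · intro hsub
        have hL'mem : L' ∈ (lines M).filter fun L : Finset α => (L ∩ D.ρ).card = (L' ∩ D.ρ).card :=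
          Finset.mem_filter.2 ⟨hL', rfl⟩
        obtain ⟨C, hC, hCeq⟩ := Finset.mem_image.1 (hsub hL'mem)
        rw [Finset.mem_filter] at hC
        obtain ⟨-, htr⟩ := class_line hs hG h2 hC.1 (by omega)
        rw [← hCeq, htr] at hncl
        exact hncl hC.1 }

/-- `#{l ∈ lineTraces : |l| = m} ≤ ν_m` under the shared hypotheses (`2 ≤ n`, `|ρ| ≤ 7`). -/
theorem card_lineTraces_le_nu_of (hs : Simple M) (hG : G ⊆ gr M) (h2 : 2 ≤ D.L.card) (hp7 : D.ρ.card ≤ 7)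
    (m : ℕ) (hm : 2 ≤ m) :
    (D.lineTraces.filter fun l => l.card = m).card ≤ PL.nu D.profile m := by
  have hCl : ∀ C ∈ D.classes.filter (fun C => m = C.card), clF M C ∈ lines M ∧ clF M C ∩ D.ρ = C :=
    fun C hC => by
      rw [Finset.mem_filter] at hC
      exact class_line hs hG h2 hC.1 (by omega)
  have hNl : ∀ l ∈ D.lineTraces.filter (fun l => l.card = m), clF M l ∈ lines M ∧ clF M l ∩ D.ρ = l :=
    fun l hl => clF_lineTrace hs hG (Finset.mem_filter.1 hl).1
  have hinjC : Set.InjOn (fun C => clF M C) ↑(D.classes.filter fun C => m = C.card) :=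
    fun C hC C' hC' heq => by
      simp only at heq
      rw [← (hCl C hC).2, ← (hCl C' hC').2, heq]
  have hinjN : Set.InjOn (fun l => clF M l) ↑(D.lineTraces.filter fun l => l.card = m) :=
    fun l hl l' hl' heq => by
      simp only at heq
      rw [← (hNl l hl).2, ← (hNl l' hl').2, heq]
  have hdisj : Disjoint ((D.classes.filter fun C => m = C.card).image fun C => clF M C)
      ((D.lineTraces.filter fun l => l.card = m).image fun l => clF M l) := by
    rw [Finset.disjoint_left]
    intro X hX hX'
    obtain ⟨C, hC, rfl⟩ := Finset.mem_image.1 hX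
    obtain ⟨l, hl, heq⟩ := Finset.mem_image.1 hX'
    have hlC : l = C := by rw [← (hNl l hl).2, ← (hCl C hC).2, heq]
    have hl' := (Finset.mem_filter.1 (Finset.mem_filter.1 hl).1).2.2
    exact hl' (hlC ▸ (Finset.mem_filter.1 hC).1)
  have hsub : ((D.classes.filter fun C => m = C.card).image fun C => clF M C) ∪
      ((D.lineTraces.filter fun l => l.card = m).image fun l => clF M l) ⊆
      (lines M).filter fun L : Finset α => (L ∩ D.ρ).card = m := by
    intro X hX
    rw [Finset.mem_union] at hX
    rcases hX with hX | hX
    · obtain ⟨C, hC, rfl⟩ := Finset.mem_image.1 hX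
      have := hCl C hC
      rw [Finset.mem_filter, this.2]
      exact ⟨this.1, (Finset.mem_filter.1 hC).2.symm⟩
    · obtain ⟨l, hl, rfl⟩ := Finset.mem_image.1 hX
      have := hNl l hl
      rw [Finset.mem_filter, this.2]
      exact ⟨this.1, (Finset.mem_filter.1 hl).2⟩
  have hcard := Finset.card_le_card hsub
  rw [Finset.card_union_of_disjoint hdisj, Finset.card_image_of_injOn hinjC,
    Finset.card_image_of_injOn hinjN] at hcard
  have hcnt : D.profile.sizes.count m = (D.classes.filter fun C => m = C.card).card := sizes_count m
  have hinc : PL.incOf D.profile m = ((lines M).filter fun L : Finset α => (L ∩ D.ρ).card = m).card := by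
    rcases Nat.lt_or_ge m 8 with hm8 | hm8
    · unfold PL.incOf
      rw [if_pos hm, inc_profile _ (by omega), show m - 2 + 2 = m by omega]
      rfl
    · have h0 : ((lines M).filter fun L : Finset α => (L ∩ D.ρ).card = m).card = 0 := by
        rw [Finset.card_eq_zero, Finset.filter_eq_empty_iff]
        intro L _ hL
        have := Finset.card_le_card (Finset.inter_subset_right : L ∩ D.ρ ⊆ D.ρ)
        omega
      rw [h0]
      unfold PL.incOf
      rw [if_pos hm]
      show ((List.range 6).map fun i => inc M D.ρ (i + 2)).getD (m - 2) 0 = 0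
      rw [List.getD_eq_getElem?_getD, List.getElem?_eq_none (by simp; omega)]
      rfl
  show (D.lineTraces.filter fun l => l.card = m).card ≤ PL.incOf D.profile m - D.profile.sizes.count m
  rw [hinc, hcnt]
  exact Nat.le_sub_of_add_le (by rw [Nat.add_comm]; exact hcard)

/-- A non-class line trace misses a point of `ρ` (a line trace has rank `≤ 2`, `ρ` has rank `3`). -/
theorem card_lineTrace_lt {l : Finset α} (hl : l ∈ D.lineTraces) : l.card + 1 ≤ D.ρ.card := by
  obtain ⟨hmem, -, -⟩ := Finset.mem_filter.1 hl
  obtain ⟨L', hL', rfl⟩ := Finset.mem_image.1 hmem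
  have hne : L' ∩ D.ρ ≠ D.ρ := by
    intro h
    have hsub : D.ρ ⊆ L' := by rw [← h]; exact Finset.inter_subset_left
    have := M.eRk_mono (Finset.coe_subset.2 hsub)
    rw [D.eRk_ρ, (mem_lines.1 hL').2.2] at this
    exact absurd this (by decide)
  have := Finset.card_lt_card (Finset.ssubset_iff_subset_ne.2 ⟨Finset.inter_subset_right, hne⟩)
  omega

/-- In the meeting case every class has at least two points (`z = ℓ ∩ ρ` and its own `y ∉ ℓ`). -/
theorem two_le_card_class_of_meet (hs : Simple M) (hG : G ⊆ gr M) (h2 : 2 ≤ D.L.card)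
    (hmeet : D.profile.meet = true) {A : Finset α} (hA : A ∈ D.classes) : 2 ≤ A.card := by
  have h1 : (D.ellF ∩ D.ρ).card = 1 := by
    have : D.profile.meet = decide ((D.ellF ∩ D.ρ).card = 1) := rfl
    rw [this, decide_eq_true_iff] at hmeet
    exact hmeet
  obtain ⟨z, hz⟩ := Finset.card_eq_one.1 h1
  have hzmem : z ∈ D.ellF ∩ D.ρ := by rw [hz]; exact Finset.mem_singleton_self z
  rw [Finset.mem_inter] at hzmem
  obtain ⟨y, hy, rfl⟩ := Finset.mem_image.1 hA
  rw [Finset.mem_sdiff] at hy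
  have hyA : y ∈ D.lam y := mem_lam_self hs hG h2 hy.1 hy.2
  have hzA : z ∈ D.lam y := mem_lam_of_mem_ellF hzmem.1 hzmem.2
  have hne : y ≠ z := fun h => hy.2 (h ▸ hzmem.1)
  exact Finset.one_lt_card.2 ⟨y, hyA, z, hzA, hne⟩

/-- The `X̄′` facts under the cap `s_j + 3 ≤ p` and the shared hypotheses. -/
theorem traceDataNew_of (hs : Simple M) (hG : G ⊆ gr M) (h2 : 2 ≤ D.L.card) (hp7 : D.ρ.card ≤ 7)
    (hcap3 : ∀ A ∈ D.classes, A.card + 3 ≤ D.ρ.card) :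
    PLTraceDataNew D.profile D.ρ D.L D.classes D.lineTraces where
  cap3 := hcap3
  line_lt := fun l hl => card_lineTrace_lt hl
  nu_count := by
    intro m
    rcases Nat.lt_or_ge m 2 with hm | hm
    · have h0 : (D.lineTraces.filter fun l => l.card = m) = ∅ := by
        rw [Finset.filter_eq_empty_iff]
        intro l hl
        have := (Finset.mem_filter.1 hl).2.1
        omega
      rw [h0, Finset.card_empty]
      exact Nat.zero_le _
    · exact card_lineTraces_le_nu_of hs hG h2 hp7 m hm
  meet_two := fun hmeet A hA => two_le_card_class_of_meet hs hG h2 hmeet hA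

/-- With plane traces `≤ g − 3`: `|λ_y| + 3 ≤ p` for every class (`Π_y ∩ G = L ∪ λ_y` is a plane trace). -/
theorem card_class_add_three_le (hs : Simple M) (hG : G ⊆ gr M) (h2 : 2 ≤ D.L.card)
    (hpl : ∀ P ∈ planes M, (P ∩ G).card + 3 ≤ G.card) {A : Finset α} (hA : A ∈ D.classes) :
    A.card + 3 ≤ D.ρ.card := by
  obtain ⟨y, hy, rfl⟩ := Finset.mem_image.1 hA
  have hyG : y ∈ G := D.ρ_subset (Finset.mem_sdiff.1 hy).1
  have hyℓ : y ∉ D.ellF := (Finset.mem_sdiff.1 hy).2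
  have hPi := (Pi_mem_planes hs hG h2 hyG hyℓ).1
  have hcard : (D.Pi y ∩ G).card = D.L.card + (D.lam y).card := by
    rw [Pi_inter_G_eq hs hG h2 y, Finset.card_union_of_disjoint]
    exact Finset.disjoint_left.2 fun z hzL hzlam =>
      Finset.disjoint_left.1 disjoint_ρ_L (Finset.mem_inter.1 hzlam).2 hzL
  have := hpl _ hPi
  have hg := D.card_ρ_add_card_L
  omega

/-- **Step (4) with Lemma `X̄′`**: `Xcnt M G ≤ X̄′(profile D)` for plane traces `≤ g − 3` and `7 ≤ g ≤ 10`
(the `g ∈ {8, 9}` piece of `SixFourResidue`, §21.18.9). -/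
theorem Xcnt_le_Xbar'_profile (hs : Simple M) (hG : G ⊆ gr M) (hr : M.eRk (G : Set α) = 4)
    (hpl : ∀ P ∈ planes M, (P ∩ G).card + 3 ≤ G.card) (hg : 7 ≤ G.card) (hg10 : G.card ≤ 10) :
    Xcnt M G ≤ PL.Xbar' D.profile := by
  have hp := hpl _ D.plane
  have hsum := D.card_ρ_add_card_L
  have h3 : 3 ≤ D.L.card := by unfold ρ at hsum; omega
  have h2 : 2 ≤ D.L.card := by omega
  have hp7 : D.ρ.card ≤ 7 := by unfold ρ; omega
  have hcap3 : ∀ A ∈ D.classes, A.card + 3 ≤ D.ρ.card := fun A hA => card_class_add_three_le hs hG h2 hpl hA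
  exact Xcnt_le_Xbar'_seam D.ρ_union_L.symm hG hr
    (traceData_of hs hG h3 hp7 fun A hA => by have := hcap3 A hA; omega)
    (traceDataNew_of hs hG h2 hp7 hcap3) D.injOn_planes3 (D.image_planes3_subset_tracesOf hs hG h2)

end PLData

end PercRepro.SixFour
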